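import Literature.Analysis.FunctionSpaces.PoissonMeckeProofs
import Literature.Analysis.FunctionSpaces.PointConfigKernel
import Mathlib.MeasureTheory.Measure.Lebesgue.EqHaar
import Mathlib.MeasureTheory.Measure.Haar.OfBasis
import Mathlib.MeasureTheory.Constructions.Pi
import Mathlib.Analysis.Complex.Basic
import Mathlib.MeasureTheory.Measure.Lebesgue.Complex
import Mathlib.Tactic.LinearCombination
import HarnessLib

/-!
# Planar Poisson processes are in general position: a.s. no four points are cocircular

Topic `Literature/Probability/RandomPlanarGeometry`; a theorem wanted with the definition requests
`defn-PoissonVoronoiGraph` / `defn-PoissonVoronoiSAWLaw` (route `CriticalPhenomena/SAWPoissonHoneycomb`):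
"a.s. general position: every [Voronoi] vertex has exactly 3 nearest sites and degree 3 (the
'Poisson honeycomb' is trivalent)". Everything here is PROVED; no definition, no named fact.

**Statement** (`IsPoissonPointProcess.ae_forall_encard_inter_sphere_le_three`). Let `P` be a
Poisson point process on `ℂ` (Kingman's axioms, `IsPoissonPointProcess ν P`) whose σ-finite
intensity `ν` is absolutely continuous with respect to Lebesgue measure. Then almost surely no
circle (or point) carries four points of the configuration:
`∀ᵐ ω ∂P, ∀ c r, #(ω ∩ sphere c r) ≤ 3`.
Bollobás–Riordan, *Percolation* (2006), Ch. 8 §8.3 state the consequence ("with probability 1 …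
for any `k`-dimensional face … there are exactly `d+1-k` Voronoi cells containing it": vertices
of the planar tessellation lie in exactly three cells); the standard proof, formalised here, is
the multivariate Mecke (Campbell) formula: the expected number of ordered `4`-tuples of distinct
points of `ω` lying in a Lebesgue-null `N ⊆ ℂ⁴` is `ν^{⊗4}(N) = 0` (Last–Penrose 2017, Thm 4.4),
for a null set `N` containing all cocircular `4`-tuples.

## Proof

* `N = {x₀ = x₁} ∪ {x₀ ≠ x₁, (x₁-x₀) ∥ (x₂-x₀)} ∪ {dist x₃ K(x) = dist x₀ K(x)}`, where `K(x)` is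
  the explicit solution (Cramer's rule) of the two perpendicular-bisector equations
  `Re(c · conj(xᵢ - x₀)) = (|xᵢ|² - |x₀|²)/2`, `i = 1, 2` — the circumcentre of `x₀x₁x₂` when these
  are not collinear (`center_mul_det_eq_of_dist_eq`: a common centre of `x₀, x₁, x₂` IS `K(x)`);
  so every cocircular `4`-tuple lies in `N`.
* Each piece of `N` has Lebesgue-null sections in one coordinate (a point; a line,
  `volume_setOf_line_eq_zero` via `Measure.addHaar_affineSubspace`; a circle,
  `Measure.addHaar_sphere`), hence is `ν^{⊗4}`-null by Tonelli in that coordinate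
  (`pi_null_of_forall_insertNth_null`) and `ν ≪ volume`.
* Mecke (the tree's PROVED `IsPoissonPointProcess.lintegral_tsum_injective_eq`, Last–Penrose
  Thm 4.4) gives `E ∑_{x ∈ ω⁴ distinct} 1_N(x) = ν^{⊗4}(N) = 0`; the sum is a measurable function
  of `ω` (the tree's `exists_measurable_tsum_injective`), so it vanishes a.s., i.e. a.s. no four
  distinct points of `ω` are cocircular; four points of `ω ∩ sphere c r` would be.

## References

* G. Last, M. Penrose, *Lectures on the Poisson Process*, CUP (2017), Theorem 4.4 (multivariate
  Mecke equation). [`LastPenrose2017`]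
* B. Bollobás, O. Riordan, *Percolation*, CUP (2006), Ch. 8 §8.3 (a.s. general position of the
  Poisson–Voronoi tessellation). [`BollobasRiordan2006`]
-/

noncomputable section

open MeasureTheory ProbabilityTheory Set Function Metric Filter
open scoped ENNReal NNReal Topology

namespace Literature.Probability.RandomPlanarGeometry

open Literature.Analysis.FunctionSpaces

/-! ### Tonelli: a measurable set with null sections in one coordinate is null -/

/-- A measurable subset of `Fin (n+1) → α` all of whose sections in the coordinate `i` are
`μ i`-null is `⊗ⱼ μ j`-null (Tonelli in the coordinate `i`, `measurePreserving_piFinSuccAbove`).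
[folklore] -/
theorem pi_null_of_forall_insertNth_null {n : ℕ} {α : Type*} [MeasurableSpace α]
    (μ : Fin (n + 1) → Measure α) [∀ i, SigmaFinite (μ i)] (i : Fin (n + 1))
    {S : Set (Fin (n + 1) → α)} (hS : MeasurableSet S)
    (h : ∀ y : Fin n → α, μ i {z | Fin.insertNth i z y ∈ S} = 0) : Measure.pi μ S = 0 := by
  have hmp := measurePreserving_piFinSuccAbove μ i
  set e := MeasurableEquiv.piFinSuccAbove (fun _ : Fin (n + 1) => α) i with he
  have hpre : S = e ⁻¹' (e.symm ⁻¹' S) := by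
    rw [← preimage_comp, MeasurableEquiv.symm_comp_self, preimage_id]
  rw [hpre, hmp.measure_preimage (e.symm.measurable hS).nullMeasurableSet,
    Measure.prod_apply_symm (e.symm.measurable hS)]
  have hsec : ∀ y : Fin n → α, μ i ((fun z => (z, y)) ⁻¹' (e.symm ⁻¹' S)) = 0 := fun y => h y
  simp_rw [hsec, lintegral_zero]

/-! ### Lines and circles are Lebesgue-null in `ℂ` -/

/-- A straight line `{z | Im-part condition}` through `p` with direction `w ≠ 0`, written as
`w.re · Im(z - p) = w.im · Re(z - p)`, is Lebesgue-null in `ℂ` (a proper affine subspace).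
[folklore] -/
theorem volume_setOf_line_eq_zero {w : ℂ} (hw : w ≠ 0) (p : ℂ) :
    volume {z : ℂ | w.re * (z - p).im - w.im * (z - p).re = 0} = 0 := by
  -- the linear functional `z ↦ w.re · Im z - w.im · Re z`
  set φ : ℂ →ₗ[ℝ] ℝ := w.re • Complex.imLm - w.im • Complex.reLm with hφ
  have hφ_apply : ∀ z : ℂ, φ z = w.re * z.im - w.im * z.re := fun z => by
    simp [hφ, sub_eq_add_neg]
  set A : AffineSubspace ℝ ℂ := AffineSubspace.mk' p (LinearMap.ker φ) with hA
  have hset : {z : ℂ | w.re * (z - p).im - w.im * (z - p).re = 0} = (A : Set ℂ) := by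
    ext z
    simp only [mem_setOf_eq, hA, SetLike.mem_coe, AffineSubspace.mem_mk', LinearMap.mem_ker,
      vsub_eq_sub, hφ_apply]
  have hne : A ≠ ⊤ := by
    intro htop
    have hdir : LinearMap.ker φ = ⊤ := by
      rw [← AffineSubspace.direction_mk' p (LinearMap.ker φ), ← hA, htop,
        AffineSubspace.direction_top]
    have hz : (⟨-w.im, w.re⟩ : ℂ) ∈ LinearMap.ker φ := hdir ▸ Submodule.mem_top
    rw [LinearMap.mem_ker, hφ_apply] at hz
    apply hw
    have h0 : Complex.normSq w = 0 := by
      rw [Complex.normSq_apply]; dsimp at hz; nlinarith [hz]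
    exact Complex.normSq_eq_zero.1 h0
  rw [hset]
  exact Measure.addHaar_affineSubspace volume A hne

/-! ### The circumcentre by Cramer's rule -/

/-- **A common centre solves the bisector system.** If `c` is equidistant from `x₀, x₁, x₂`
then, with `a = x₁ - x₀`, `b = x₂ - x₀`, `α = (|x₁|² - |x₀|²)/2`, `β = (|x₂|² - |x₀|²)/2` and
`D = a.re b.im - a.im b.re`, one has `c.re · D = α b.im - β a.im` and `c.im · D = a.re β - b.re α`
(the perpendicular-bisector equations `c.re aᵣ + c.im aᵢ = α`, `c.re bᵣ + c.im bᵢ = β` solved by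
Cramer's rule; for `D ≠ 0` this determines `c`). [folklore] -/
theorem center_mul_det_eq_of_dist_eq {x₀ x₁ x₂ c : ℂ} (h₁ : dist x₁ c = dist x₀ c)
    (h₂ : dist x₂ c = dist x₀ c) :
    c.re * ((x₁ - x₀).re * (x₂ - x₀).im - (x₁ - x₀).im * (x₂ - x₀).re) =
        (Complex.normSq x₁ - Complex.normSq x₀) / 2 * (x₂ - x₀).im -
          (Complex.normSq x₂ - Complex.normSq x₀) / 2 * (x₁ - x₀).im ∧
      c.im * ((x₁ - x₀).re * (x₂ - x₀).im - (x₁ - x₀).im * (x₂ - x₀).re) =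
        (x₁ - x₀).re * ((Complex.normSq x₂ - Complex.normSq x₀) / 2) -
          (x₂ - x₀).re * ((Complex.normSq x₁ - Complex.normSq x₀) / 2) := by
  have e1 : Complex.normSq (x₁ - c) = Complex.normSq (x₀ - c) := by
    have := congrArg (fun t : ℝ => t ^ 2) h₁
    simpa only [Complex.dist_eq, Complex.sq_norm] using this
  have e2 : Complex.normSq (x₂ - c) = Complex.normSq (x₀ - c) := by
    have := congrArg (fun t : ℝ => t ^ 2) h₂
    simpa only [Complex.dist_eq, Complex.sq_norm] using this
  simp only [Complex.normSq_apply, Complex.sub_re, Complex.sub_im] at e1 e2 ⊢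
  constructor
  · linear_combination (-(x₂.im - x₀.im) / 2) * e1 + ((x₁.im - x₀.im) / 2) * e2
  · linear_combination ((x₂.re - x₀.re) / 2) * e1 - ((x₁.re - x₀.re) / 2) * e2

/-! ### Four points out of a set with `encard ≥ 4` -/

/-- A set with at least four elements contains an injective `4`-tuple. [folklore] -/
theorem exists_injective_of_four_le_encard {α : Type*} {s : Set α} (hs : 4 ≤ s.encard) :
    ∃ x : Fin 4 → α, Injective x ∧ ∀ i, x i ∈ s := by
  obtain ⟨t, hts, ht⟩ := exists_subset_encard_eq (k := 4) (by exact_mod_cast hs)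
  have htfin : t.Finite := finite_of_encard_eq_coe ht
  haveI := htfin.to_subtype
  have hcard : Nat.card t = 4 := by
    rw [Nat.card_coe_set_eq, ← Nat.cast_inj (R := ℕ∞), htfin.cast_ncard_eq, ht]; rfl
  let e : t ≃ Fin 4 := (Finite.equivFin t).trans (finCongr hcard)
  refine ⟨fun i => (e.symm i : α), Subtype.val_injective.comp e.symm.injective, fun i => hts (e.symm i).2⟩

/-! ### The theorem -/

/-- **Planar Poisson processes are a.s. in general position (no four cocircular points).** For a
Poisson point process on `ℂ` with σ-finite intensity `ν ≪ volume`, almost surely every circle —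
and every point, `r = 0`, and the empty spheres, `r < 0` — carries at most three points of the
configuration: `#(ω ∩ sphere c r) ≤ 3` for all `c, r`. (Multivariate Mecke equation applied to
the Lebesgue-null set of cocircular `4`-tuples; Bollobás–Riordan 2006 §8.3: the Poisson–Voronoi
tessellation is a.s. in general position, every vertex lying in exactly three cells.)
[cite: LastPenrose2017, Theorem 4.4] -/
theorem _root_.Literature.Analysis.FunctionSpaces.IsPoissonPointProcess.ae_forall_encard_inter_sphere_le_three
    {ν : Measure ℂ} [SigmaFinite ν] (hν : ν ≪ volume) {P : Measure (PointConfig ℂ)}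
    (hP : IsPoissonPointProcess ν P) :
    ∀ᵐ ω ∂P, ∀ (c : ℂ) (r : ℝ), (((ω : PointConfig ℂ) : Set ℂ) ∩ sphere c r).encard ≤ 3 := by
  classical
  haveI := hP.isProbabilityMeasure
  -- Cramer's-rule circumcentre of `x 0, x 1, x 2` (junk when they are collinear)
  let D : (Fin 4 → ℂ) → ℝ := fun x =>
    (x 1 - x 0).re * (x 2 - x 0).im - (x 1 - x 0).im * (x 2 - x 0).re
  let Kre : (Fin 4 → ℂ) → ℝ := fun x =>
    ((Complex.normSq (x 1) - Complex.normSq (x 0)) / 2 * (x 2 - x 0).im -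
      (Complex.normSq (x 2) - Complex.normSq (x 0)) / 2 * (x 1 - x 0).im) / D x
  let Kim : (Fin 4 → ℂ) → ℝ := fun x =>
    ((x 1 - x 0).re * ((Complex.normSq (x 2) - Complex.normSq (x 0)) / 2) -
      (x 2 - x 0).re * ((Complex.normSq (x 1) - Complex.normSq (x 0)) / 2)) / D x
  let K : (Fin 4 → ℂ) → ℂ := fun x => ⟨Kre x, Kim x⟩
  -- the null set
  set N : Set (Fin 4 → ℂ) := {x | x 0 = x 1} ∪ ({x | x 0 ≠ x 1 ∧ D x = 0} ∪
    {x | dist (x 3) (K x) = dist (x 0) (K x)}) with hN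
  -- measurability
  have hcoord : ∀ i : Fin 4, Continuous fun x : Fin 4 → ℂ => x i := fun i => continuous_apply i
  have hD : Continuous D := by
    simp only [D]
    fun_prop
  have hKre : Measurable Kre := by
    refine Measurable.div (Continuous.measurable ?_) hD.measurable
    fun_prop
  have hKim : Measurable Kim := by
    refine Measurable.div (Continuous.measurable ?_) hD.measurable
    fun_prop
  have hK : Measurable K := by
    have : K = Complex.measurableEquivRealProd.symm ∘ fun x => (Kre x, Kim x) := by
      funext x; rfl
    rw [this]
    exact Complex.measurableEquivRealProd.symm.measurable.comp (hKre.prodMk hKim)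
  have hNmeas : MeasurableSet N := by
    refine MeasurableSet.union ?_ (MeasurableSet.union (MeasurableSet.inter ?_ ?_) ?_)
    · exact measurableSet_eq_fun (hcoord 0).measurable (hcoord 1).measurable
    · exact (measurableSet_eq_fun (hcoord 0).measurable (hcoord 1).measurable).compl
    · exact measurableSet_eq_fun hD.measurable measurable_const
    · exact measurableSet_eq_fun (((hcoord 3).measurable).dist hK) (((hcoord 0).measurable).dist hK)
  -- every cocircular injective 4-tuple lies in `N`
  have hmemN : ∀ x : Fin 4 → ℂ, ∀ c : ℂ, ∀ r : ℝ, (∀ i, x i ∈ sphere c r) → x ∈ N := by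
    intro x c r hx
    simp only [mem_sphere] at hx
    by_cases h01 : x 0 = x 1
    · exact Or.inl h01
    by_cases hD0 : D x = 0
    · exact Or.inr (Or.inl ⟨h01, hD0⟩)
    refine Or.inr (Or.inr ?_)
    -- `c = K x`
    have hc := center_mul_det_eq_of_dist_eq (x₀ := x 0) (x₁ := x 1) (x₂ := x 2) (c := c)
      ((hx 1).trans (hx 0).symm) ((hx 2).trans (hx 0).symm)
    have hcK : c = K x := by
      apply Complex.ext
      · change c.re = Kre x
        simp only [Kre]
        rw [eq_div_iff hD0]
        exact hc.1
      · change c.im = Kim x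
        simp only [Kim]
        rw [eq_div_iff hD0]
        exact hc.2
    change dist (x 3) (K x) = dist (x 0) (K x)
    rw [← hcK, hx 3, hx 0]
  -- `N` is `ν^{⊗4}`-null: each piece has Lebesgue-null sections in one coordinate
  have hνnull : ∀ s : Set ℂ, volume s = 0 → ν s = 0 := fun s hs => hν hs
  have hA : Measure.pi (fun _ : Fin 4 => ν) {x : Fin 4 → ℂ | x 0 = x 1} = 0 := by
    -- sections in coordinate `0` are points
    refine pi_null_of_forall_insertNth_null _ 0
      (measurableSet_eq_fun (hcoord 0).measurable (hcoord 1).measurable) fun y => ?_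
    have : {z : ℂ | Fin.insertNth (0 : Fin 4) z y ∈ {x : Fin 4 → ℂ | x 0 = x 1}} = {y 0} := by
      ext z
      simp only [mem_setOf_eq, mem_singleton_iff, Fin.insertNth_zero']
      rfl
    rw [this]
    exact hνnull _ (measure_singleton _)
  have hB : Measure.pi (fun _ : Fin 4 => ν) {x : Fin 4 → ℂ | x 0 ≠ x 1 ∧ D x = 0} = 0 := by
    -- sections in coordinate `2` are lines (or empty)
    refine pi_null_of_forall_insertNth_null _ 2 (MeasurableSet.inter
      (measurableSet_eq_fun (hcoord 0).measurable (hcoord 1).measurable).compl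
      (measurableSet_eq_fun hD.measurable measurable_const)) fun y => ?_
    have h0 : ∀ z : ℂ, (Fin.insertNth (2 : Fin 4) z y : Fin 4 → ℂ) 0 = y 0 := fun z => rfl
    have h1 : ∀ z : ℂ, (Fin.insertNth (2 : Fin 4) z y : Fin 4 → ℂ) 1 = y 1 := fun z => rfl
    have h2 : ∀ z : ℂ, (Fin.insertNth (2 : Fin 4) z y : Fin 4 → ℂ) 2 = z := fun z => rfl
    by_cases hy : y 0 = y 1
    · have : {z : ℂ | Fin.insertNth (2 : Fin 4) z y ∈ {x : Fin 4 → ℂ | x 0 ≠ x 1 ∧ D x = 0}} = ∅ := by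
        ext z
        simp only [mem_setOf_eq, mem_empty_iff_false, iff_false, not_and, h0, h1]
        exact fun h => absurd hy h
      rw [this, measure_empty]
    · have hw : y 1 - y 0 ≠ 0 := sub_ne_zero.2 (Ne.symm hy)
      have : {z : ℂ | Fin.insertNth (2 : Fin 4) z y ∈ {x : Fin 4 → ℂ | x 0 ≠ x 1 ∧ D x = 0}} =
          {z : ℂ | (y 1 - y 0).re * (z - y 0).im - (y 1 - y 0).im * (z - y 0).re = 0} := by
        ext z
        simp only [mem_setOf_eq, D, h0, h1, h2]
        exact ⟨fun h => h.2, fun h => ⟨hy, h⟩⟩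
      rw [this]
      exact hνnull _ (volume_setOf_line_eq_zero hw (y 0))
  have hC : Measure.pi (fun _ : Fin 4 => ν)
      {x : Fin 4 → ℂ | dist (x 3) (K x) = dist (x 0) (K x)} = 0 := by
    -- sections in coordinate `3` are circles
    refine pi_null_of_forall_insertNth_null _ 3
      (measurableSet_eq_fun (((hcoord 3).measurable).dist hK) (((hcoord 0).measurable).dist hK))
      fun y => ?_
    have h0 : ∀ w : ℂ, (Fin.insertNth (3 : Fin 4) w y : Fin 4 → ℂ) 0 = y 0 := fun w => rfl
    have h1 : ∀ w : ℂ, (Fin.insertNth (3 : Fin 4) w y : Fin 4 → ℂ) 1 = y 1 := fun w => rfl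
    have h2 : ∀ w : ℂ, (Fin.insertNth (3 : Fin 4) w y : Fin 4 → ℂ) 2 = y 2 := fun w => rfl
    have h3 : ∀ z : ℂ, (Fin.insertNth (3 : Fin 4) z y : Fin 4 → ℂ) 3 = z := fun z => rfl
    -- `K` does not depend on the coordinate `3`
    have hK3 : ∀ z : ℂ, K (Fin.insertNth (3 : Fin 4) z y) = K (Fin.insertNth (3 : Fin 4) 0 y) := by
      intro z
      simp only [K, Kre, Kim, D, h0, h1, h2]
    set K₀ := K (Fin.insertNth (3 : Fin 4) 0 y) with hK₀
    have : {z : ℂ | Fin.insertNth (3 : Fin 4) z y ∈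
        {x : Fin 4 → ℂ | dist (x 3) (K x) = dist (x 0) (K x)}} = sphere K₀ (dist (y 0) K₀) := by
      ext z
      simp only [mem_setOf_eq, mem_sphere, hK3, h3, h0]
    rw [this]
    exact hνnull _ (Measure.addHaar_sphere volume K₀ _)
  have hpiN : Measure.pi (fun _ : Fin 4 => ν) N = 0 := by
    rw [hN]
    exact measure_union_null hA (measure_union_null hB hC)
  -- Mecke: `E ∑_{x ∈ ω⁴ distinct} 1_N(x) = ν^{⊗4}(N) = 0`
  set H : (Fin 4 → ℂ) × PointConfig ℂ → ℝ≥0∞ := fun p => N.indicator 1 p.1 with hH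
  have hHm : Measurable H := (measurable_one.indicator hNmeas).comp measurable_fst
  have hMecke := hP.lintegral_tsum_injective_eq 4 H hHm
  have hRHS : ∫⁻ x, ∫⁻ c, H (x, c ∪ PointConfig.ofFn x) ∂P ∂(Measure.pi fun _ : Fin 4 => ν) = 0 := by
    have : ∀ x : Fin 4 → ℂ, ∫⁻ c, H (x, c ∪ PointConfig.ofFn x) ∂P = N.indicator 1 x := by
      intro x
      simp only [hH, lintegral_const, measure_univ, mul_one]
    simp_rw [this, lintegral_indicator_one hNmeas, hpiN]
  rw [hRHS] at hMecke
  -- the sum is a measurable function of `ω`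
  obtain ⟨Φ, hΦm, hΦ⟩ := IsPoissonPointProcess.exists_measurable_tsum_injective
    (PointConfig.countKernel (E := ℂ)) univ (fun c _ => PointConfig.countKernel_apply c)
    (fun c _ => c.countable_carrier) 4 (α := Unit)
    (fun p => N.indicator 1 p.2.1) ((measurable_one.indicator hNmeas).comp measurable_snd.fst)
  have hSm : Measurable fun c : PointConfig ℂ =>
      ∑' x : {x : Fin 4 → ℂ // Injective x ∧ ∀ i, x i ∈ c}, H (x.1, c) := by
    have : (fun c : PointConfig ℂ => ∑' x : {x : Fin 4 → ℂ // Injective x ∧ ∀ i, x i ∈ c},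
        H (x.1, c)) = fun c => Φ ((), c) := by
      funext c
      rw [hΦ () c (mem_univ c)]
    rw [this]
    exact hΦm.comp (measurable_const.prodMk measurable_id)
  have hae := (lintegral_eq_zero_iff hSm).1 hMecke
  -- conclusion
  filter_upwards [hae] with ω hω c r
  by_contra hlt
  push Not at hlt
  have h4 : (4 : ℕ∞) ≤ ((ω : Set ℂ) ∩ sphere c r).encard := Order.add_one_le_of_lt hlt
  obtain ⟨x, hxinj, hx⟩ := exists_injective_of_four_le_encard h4
  have hxN : x ∈ N := hmemN x c r fun i => (hx i).2
  have hterm : H (x, ω) = 0 := by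
    have := ENNReal.tsum_eq_zero.1 hω ⟨x, hxinj, fun i => (hx i).1⟩
    exact this
  simp [hH, hxN] at hterm

end Literature.Probability.RandomPlanarGeometry
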